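import Summits.QuantumFields.YangMills.Theorems.FemtoTransferGapSpectralSumsBudget
import HarnessLib

/-!
# DRESSED RITZ RATIOS AND CROSS COUPLINGS from norm-currency concentration (pure real sequences; F9-II′ for S-PSCAL″ of crux `DressedRitz`,
# stmt-QuantumFields-20205, line «polyakovlift» r6; LEAD prover ym-lead-20205-polyakovlift g2)

Setting as in `FemtoTransferGapSpectralSumsBudget`: `λ_k` antitone non-negative, `a_k = ⟨v, e_k⟩`, `N = Σ λ_k^{2n} a_k²`, `D = Σ λ_k^{2n+1} a_k²`,
a cluster window `[m₁, m₂) ∋ j₀` (`λ_c := λ_{j₀}`, spread `σ`), Bessel `Σ a_k² ≤ nv = ‖v‖²`.  The point of this file: the dressing exponent `n`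
(`= L` steps in the line) ITSELF supplies the `1/L` of the lower position budget, through the elementary weight bound

* ★ `pow_mul_sub_le`: `t^p (κ − t) ≤ κ^{p+1}/(p+1)` for `0 ≤ t ≤ κ`;
* ★ `dressed_lower_sharp`: `λ_c N − D ≤ λ_{m₁}^{2n}·σ·in + λ_c^{2n+1}/(2n+1)·(nv − Σ_{k<m₂} a_k²)` — no first-moment slop, no energy of the vector is ever formed;
* ★★ `ratio_two_sided`: if `nv ≤ (1+ϑ)·in` (norm-currency concentration in the window), `λ_0^{2n} ≤ Γ·λ_low^{2n}` on the window, and the two scalar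
  smallness conditions `Γ((λ_0 − λ_c)ϑ + σ) ≤ τλ_c`, `Γ(σ + λ_cϑ/(2n+1)) ≤ (τ/2)λ_c` hold (`0 ≤ τ ≤ 1`), then `0 < N`, `D ≤ e^{τ} λ_c N` and `λ_c N ≤ e^{τ} D`
  — the two-sided clause (o5′);
* ★★ `cross_sharp`: for two vectors concentrated (`nv ≤ (1+ϑ)·in`) in windows `W_a, W_b ⊆ [0, M)` and a pivot `κ ≥ λ_M`:
  `|D_{ab} − κN_{ab}| ≤ (λ_0^{2n}(ω₁ + 2√ϑ·ω₀) + κ^{2n+1}ϑ/(2n+1))·√nv_a·√nv_b`, `ω₀ ≥ |λ_k − κ|` on `k < M`, `ω₁ ≥ |λ_k − κ|` on `W_a ∩ W_b`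
  — the off-diagonal clause (o6′).

HONEST FRAMING: real-analysis plumbing for fixed-lattice one-site bookkeeping on the conditional femto rung R2b1; nothing here bears on infinite volume,
the continuum limit or the Clay gap.  References: Reed–Simon IV, Thm. XIII.1 [cite: ReedSimonIV1978, Thm. XIII.1]; M. Lüscher, NPB 219 (1983) 233
[cite: Luscher1983, §3].
-/

set_option autoImplicit false

noncomputable section

open Finset
open scoped BigOperators

namespace Summit.QuantumFields.YangMills.Theorems.FemtoTransferGap.SpecSum

variable {lam a b : ℕ → ℝ}

/-! ## §1 The out-tail weight -/

/-- For `0 ≤ t ≤ κ`: `(p+1)·t^p·(κ − t) ≤ κ^{p+1} − t^{p+1}` (geometric sum, each summand `κ^i t^{p−i} ≥ t^p`). [folklore] -/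
theorem succ_mul_pow_mul_sub_le {t κ : ℝ} (ht : 0 ≤ t) (htκ : t ≤ κ) (p : ℕ) :
    ((p : ℝ) + 1) * (t ^ p * (κ - t)) ≤ κ ^ (p + 1) - t ^ (p + 1) := by
  have hgeom := geom_sum₂_mul κ t (p + 1)
  have hterm : ∀ i ∈ range (p + 1), t ^ p ≤ κ ^ i * t ^ (p + 1 - 1 - i) := by
    intro i hi
    have hip : i ≤ p := Nat.lt_succ_iff.mp (mem_range.1 hi)
    have e : p + 1 - 1 - i = p - i := by omega
    have ht' : t ^ p = t ^ i * t ^ (p - i) := by rw [← pow_add, Nat.add_sub_cancel' hip]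
    rw [e, ht']
    exact mul_le_mul_of_nonneg_right (pow_le_pow_left₀ ht htκ i) (pow_nonneg ht _)
  have hsum : ((p : ℝ) + 1) * t ^ p ≤ ∑ i ∈ range (p + 1), κ ^ i * t ^ (p + 1 - 1 - i) := by
    calc ((p : ℝ) + 1) * t ^ p = ∑ _i ∈ range (p + 1), t ^ p := by
          rw [sum_const, card_range, nsmul_eq_mul]; push_cast; ring
      _ ≤ _ := sum_le_sum hterm
  have hκt : 0 ≤ κ - t := sub_nonneg.2 htκ
  calc ((p : ℝ) + 1) * (t ^ p * (κ - t)) = (((p : ℝ) + 1) * t ^ p) * (κ - t) := by ring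
    _ ≤ (∑ i ∈ range (p + 1), κ ^ i * t ^ (p + 1 - 1 - i)) * (κ - t) := mul_le_mul_of_nonneg_right hsum hκt
    _ = κ ^ (p + 1) - t ^ (p + 1) := hgeom

/-- ★ For `0 ≤ t ≤ κ`: `t^p·(κ − t) ≤ κ^{p+1}/(p+1)` — the dressed out-tail weight (with `p = 2n`, `n = L` dressing steps, this carries the `1/L`). [folklore] -/
theorem pow_mul_sub_le {t κ : ℝ} (ht : 0 ≤ t) (htκ : t ≤ κ) (p : ℕ) :
    t ^ p * (κ - t) ≤ κ ^ (p + 1) / ((p : ℝ) + 1) := by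
  have h := succ_mul_pow_mul_sub_le ht htκ p
  have hp : (0 : ℝ) < (p : ℝ) + 1 := by positivity
  rw [le_div_iff₀ hp]
  have : 0 ≤ t ^ (p + 1) := pow_nonneg ht _
  linarith

/-! ## §2 Sharp lower position budget -/

/-- ★ **Sharp lower position budget.**  `λ_c N − D ≤ λ_{m₁}^{2n}·σ·in + λ_c^{2n+1}/(2n+1)·(nv − Σ_{k<m₂} a_k²)`: below the window the terms are `≤ 0`, on the window
the spread, beyond it the weight `λ_k^{2n}(λ_c − λ_k) ≤ λ_c^{2n+1}/(2n+1)` against the out-mass. [cite: ReedSimonIV1978, Thm. XIII.1] -/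
theorem dressed_lower_sharp (hanti : Antitone lam) (hnn : ∀ k, 0 ≤ lam k) (n : ℕ) {m₁ m₂ j₀ : ℕ} (h1 : m₁ ≤ j₀) (h2 : j₀ < m₂)
    {σ : ℝ} (hσ : ∀ k, m₁ ≤ k → k < m₂ → |lam k - lam j₀| ≤ σ) {N D A nv : ℝ}
    (hN : HasSum (fun k => lam k ^ (2 * n) * a k ^ 2) N) (hD : HasSum (fun k => lam k ^ (2 * n + 1) * a k ^ 2) D)
    (hA : HasSum (fun k => a k ^ 2) A) (hAnv : A ≤ nv) :
    lam j₀ * N - D ≤ lam m₁ ^ (2 * n) * σ * ∑ k ∈ Ico m₁ m₂, a k ^ 2 +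
      lam j₀ ^ (2 * n + 1) / (2 * (n : ℝ) + 1) * (nv - ∑ k ∈ range m₂, a k ^ 2) := by
  set κ := lam j₀ with hκ
  have hκ0 : 0 ≤ κ := hnn j₀
  have hSp : HasSum (fun k => lam k ^ (2 * n) * ((κ - lam k) * a k ^ 2)) (κ * N - D) := by
    have := (hN.mul_left κ).sub hD
    refine this.congr_fun fun k => ?_; ring
  set c : ℝ := κ ^ (2 * n + 1) / (2 * (n : ℝ) + 1) with hc
  have hden : (0 : ℝ) < 2 * (n : ℝ) + 1 := by positivity
  have hc0 : 0 ≤ c := div_nonneg (pow_nonneg hκ0 _) hden.le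
  have hg : HasSum (fun k => c * a k ^ 2) (c * A) := hA.mul_left c
  -- tail beyond `m₂`
  have htail := tail_le_of_le hSp hg m₂ fun k hk => by
    have hkκ : lam k ≤ κ := hanti (h2.le.trans hk)
    have hw : lam k ^ (2 * n) * (κ - lam k) ≤ c := by
      have h := pow_mul_sub_le (hnn k) hkκ (2 * n)
      rw [hc]
      calc lam k ^ (2 * n) * (κ - lam k) ≤ κ ^ (2 * n + 1) / (((2 * n : ℕ) : ℝ) + 1) := h
        _ = κ ^ (2 * n + 1) / (2 * (n : ℝ) + 1) := by push_cast; ring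
    calc lam k ^ (2 * n) * ((κ - lam k) * a k ^ 2) = (lam k ^ (2 * n) * (κ - lam k)) * a k ^ 2 := by ring
      _ ≤ c * a k ^ 2 := mul_le_mul_of_nonneg_right hw (sq_nonneg _)
  have hgs : ∑ k ∈ range m₂, c * a k ^ 2 = c * ∑ k ∈ range m₂, a k ^ 2 := by rw [Finset.mul_sum]
  -- finite parts
  have hsplit1 : ∑ k ∈ range m₂, lam k ^ (2 * n) * ((κ - lam k) * a k ^ 2) =
      ∑ k ∈ range m₁, lam k ^ (2 * n) * ((κ - lam k) * a k ^ 2) + ∑ k ∈ Ico m₁ m₂, lam k ^ (2 * n) * ((κ - lam k) * a k ^ 2) := by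
    rw [← Finset.sum_range_add_sum_Ico _ (h1.trans h2.le)]
  have hσ0 : ∀ k, m₁ ≤ k → k < m₂ → 0 ≤ σ := fun k hk1 hk2 => (abs_nonneg _).trans (hσ k hk1 hk2)
  have hlo1 : ∑ k ∈ range m₁, lam k ^ (2 * n) * ((κ - lam k) * a k ^ 2) ≤ 0 :=
    Finset.sum_nonpos fun k hk => by
      have hkc : κ ≤ lam k := hanti ((mem_range.1 hk).le.trans h1)
      exact mul_nonpos_iff.2 (Or.inl ⟨pow_nonneg (hnn k) _, mul_nonpos_iff.2 (Or.inr ⟨by linarith, sq_nonneg _⟩)⟩)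
  have hin1 : ∑ k ∈ Ico m₁ m₂, lam k ^ (2 * n) * ((κ - lam k) * a k ^ 2) ≤ lam m₁ ^ (2 * n) * σ * ∑ k ∈ Ico m₁ m₂, a k ^ 2 := by
    rw [Finset.mul_sum]
    refine Finset.sum_le_sum fun k hk => ?_
    obtain ⟨hk1, hk2⟩ := mem_Ico.1 hk
    have hs := (abs_le.1 (hσ k hk1 hk2)).1
    calc lam k ^ (2 * n) * ((κ - lam k) * a k ^ 2) ≤ lam k ^ (2 * n) * (σ * a k ^ 2) :=
          mul_le_mul_of_nonneg_left (mul_le_mul_of_nonneg_right (by linarith) (sq_nonneg _)) (pow_nonneg (hnn k) _)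
      _ ≤ lam m₁ ^ (2 * n) * (σ * a k ^ 2) :=
          mul_le_mul_of_nonneg_right (pow_le_pow_left₀ (hnn k) (hanti hk1) _) (mul_nonneg (hσ0 k hk1 hk2) (sq_nonneg _))
      _ = lam m₁ ^ (2 * n) * σ * a k ^ 2 := by ring
  have hcA : c * A - c * ∑ k ∈ range m₂, a k ^ 2 ≤ c * (nv - ∑ k ∈ range m₂, a k ^ 2) := by
    have := mul_le_mul_of_nonneg_left hAnv hc0
    linarith
  linarith [htail, hgs, hsplit1, hlo1, hin1, hcA]

/-! ## §3 ★★ The two-sided ratio clause from norm-currency concentration -/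

/-- ★★ **Two-sided dressed Ritz ratio.**  If the vector is concentrated in its window in NORM currency (`nv ≤ (1+ϑ)·in`, `in > 0`), the dressed powers across
`[λ_low, λ_0]` are comparable (`λ_0^{2n} ≤ Γλ_low^{2n}`), and the scalar smallness conditions hold, then the dressed Ritz value `D/N` equals `λ_c` up to `e^{±τ}`.
[cite: ReedSimonIV1978, Thm. XIII.1] [cite: Luscher1983, §3] -/
theorem ratio_two_sided (hanti : Antitone lam) (hnn : ∀ k, 0 ≤ lam k) (n : ℕ) {m₁ m₂ j₀ : ℕ} (h1 : m₁ ≤ j₀) (h2 : j₀ < m₂)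
    {σ : ℝ} (hσ : ∀ k, m₁ ≤ k → k < m₂ → |lam k - lam j₀| ≤ σ) {N D A nv : ℝ}
    (hN : HasSum (fun k => lam k ^ (2 * n) * a k ^ 2) N) (hD : HasSum (fun k => lam k ^ (2 * n + 1) * a k ^ 2) D)
    (hA : HasSum (fun k => a k ^ 2) A) (hAnv : A ≤ nv)
    (hκ : 0 < lam j₀) {lamlow : ℝ} (hlow0 : 0 < lamlow) (hlow : ∀ k, m₁ ≤ k → k < m₂ → lamlow ≤ lam k)
    {Γ : ℝ} (hΓ : lam 0 ^ (2 * n) ≤ Γ * lamlow ^ (2 * n))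
    {ϑ : ℝ} (hϑ0 : 0 ≤ ϑ) (hconc : nv ≤ (1 + ϑ) * ∑ k ∈ Ico m₁ m₂, a k ^ 2) (hin : 0 < ∑ k ∈ Ico m₁ m₂, a k ^ 2)
    {τ : ℝ} (hτ0 : 0 ≤ τ) (hτ1 : τ ≤ 1)
    (hup : Γ * ((lam 0 - lam j₀) * ϑ + σ) ≤ τ * lam j₀)
    (hlo : Γ * (σ + lam j₀ * ϑ / (2 * (n : ℝ) + 1)) ≤ τ / 2 * lam j₀) :
    0 < N ∧ D ≤ Real.exp τ * (lam j₀ * N) ∧ lam j₀ * N ≤ Real.exp τ * D := by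
  set κ := lam j₀ with hκdef
  set inn := ∑ k ∈ Ico m₁ m₂, a k ^ 2 with hinn
  set lo := ∑ k ∈ range m₁, a k ^ 2 with hlodef
  have hNlow : lamlow ^ (2 * n) * inn ≤ N := dressed_norm_lower hnn n hlow0.le hlow hN
  have hlowpos : 0 < lamlow ^ (2 * n) := pow_pos hlow0 _
  have hNpos : 0 < N := lt_of_lt_of_le (mul_pos hlowpos hin) hNlow
  have hm1 : lam m₁ ^ (2 * n) ≤ Γ * lamlow ^ (2 * n) := (pow_le_pow_left₀ (hnn m₁) (hanti (Nat.zero_le _)) _).trans hΓ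
  have hκp : κ ^ (2 * n) ≤ Γ * lamlow ^ (2 * n) := (pow_le_pow_left₀ (hnn j₀) (hanti (Nat.zero_le _)) _).trans hΓ
  -- masses
  have hsplit : ∑ k ∈ range m₂, a k ^ 2 = lo + inn := (Finset.sum_range_add_sum_Ico _ (h1.trans h2.le)).symm
  have hm2A : ∑ k ∈ range m₂, a k ^ 2 ≤ A := sum_le_of_hasSum hA (fun k => sq_nonneg _) m₂
  have hlo0 : 0 ≤ lo := Finset.sum_nonneg fun k _ => sq_nonneg _
  have hloϑ : lo ≤ ϑ * inn := by linarith
  have houtϑ : nv - ∑ k ∈ range m₂, a k ^ 2 ≤ ϑ * inn := by linarith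
  have hσ0 : 0 ≤ σ := (abs_nonneg _).trans (hσ j₀ h1 h2)
  have hexp1 : 1 + τ ≤ Real.exp τ := by have := Real.add_one_le_exp τ; linarith
  have hκN : 0 ≤ κ * N := mul_nonneg hκ.le hNpos.le
  -- UPPER: `D − κN ≤ λ_0^{2n}(λ_0−κ)lo + λ_{m₁}^{2n}σ·in ≤ Γλ_low^{2n}((λ_0−κ)ϑ + σ)·in ≤ τκ·N`
  have hU := dressed_upper hanti hnn n h1 h2 hσ hN hD
  have hl0κ : 0 ≤ lam 0 - κ := sub_nonneg.2 (hanti (Nat.zero_le _))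
  have hU1 : lam 0 ^ (2 * n) * (lam 0 - κ) * lo ≤ Γ * lamlow ^ (2 * n) * ((lam 0 - κ) * (ϑ * inn)) := by
    calc lam 0 ^ (2 * n) * (lam 0 - κ) * lo ≤ lam 0 ^ (2 * n) * (lam 0 - κ) * (ϑ * inn) :=
          mul_le_mul_of_nonneg_left hloϑ (mul_nonneg (pow_nonneg (hnn 0) _) hl0κ)
      _ = lam 0 ^ (2 * n) * ((lam 0 - κ) * (ϑ * inn)) := by ring
      _ ≤ Γ * lamlow ^ (2 * n) * ((lam 0 - κ) * (ϑ * inn)) :=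
          mul_le_mul_of_nonneg_right hΓ (mul_nonneg hl0κ (mul_nonneg hϑ0 hin.le))
  have hU2 : lam m₁ ^ (2 * n) * σ * inn ≤ Γ * lamlow ^ (2 * n) * (σ * inn) := by
    calc lam m₁ ^ (2 * n) * σ * inn = lam m₁ ^ (2 * n) * (σ * inn) := by ring
      _ ≤ _ := mul_le_mul_of_nonneg_right hm1 (mul_nonneg hσ0 hin.le)
  have hU3 : D - κ * N ≤ τ * κ * (lamlow ^ (2 * n) * inn) := by
    have e : Γ * lamlow ^ (2 * n) * ((lam 0 - κ) * (ϑ * inn)) + Γ * lamlow ^ (2 * n) * (σ * inn) =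
        (Γ * ((lam 0 - κ) * ϑ + σ)) * (lamlow ^ (2 * n) * inn) := by ring
    have h4 : (Γ * ((lam 0 - κ) * ϑ + σ)) * (lamlow ^ (2 * n) * inn) ≤ (τ * κ) * (lamlow ^ (2 * n) * inn) :=
      mul_le_mul_of_nonneg_right hup (mul_nonneg hlowpos.le hin.le)
    linarith [hU, hU1, hU2, e, h4]
  have hU4 : D - κ * N ≤ τ * κ * N := hU3.trans (mul_le_mul_of_nonneg_left hNlow (mul_nonneg hτ0 hκ.le))
  have hDup : D ≤ Real.exp τ * (κ * N) := by
    have h5 : D ≤ (1 + τ) * (κ * N) := by linarith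
    exact h5.trans (mul_le_mul_of_nonneg_right hexp1 hκN)
  -- LOWER: `κN − D ≤ λ_{m₁}^{2n}σ·in + κ^{2n+1}/(2n+1)·ϑ·in ≤ Γλ_low^{2n}(σ + κϑ/(2n+1))·in ≤ (τ/2)κ·N`
  have hL := dressed_lower_sharp hanti hnn n h1 h2 hσ hN hD hA hAnv
  have hden : (0 : ℝ) < 2 * (n : ℝ) + 1 := by positivity
  have hL1 : κ ^ (2 * n + 1) / (2 * (n : ℝ) + 1) * (nv - ∑ k ∈ range m₂, a k ^ 2) ≤
      Γ * lamlow ^ (2 * n) * (κ * ϑ / (2 * (n : ℝ) + 1) * inn) := by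
    have hc0 : 0 ≤ κ ^ (2 * n + 1) / (2 * (n : ℝ) + 1) := div_nonneg (pow_nonneg hκ.le _) hden.le
    calc κ ^ (2 * n + 1) / (2 * (n : ℝ) + 1) * (nv - ∑ k ∈ range m₂, a k ^ 2)
        ≤ κ ^ (2 * n + 1) / (2 * (n : ℝ) + 1) * (ϑ * inn) := mul_le_mul_of_nonneg_left houtϑ hc0
      _ = κ ^ (2 * n) * (κ * ϑ / (2 * (n : ℝ) + 1) * inn) := by rw [pow_succ]; ring
      _ ≤ Γ * lamlow ^ (2 * n) * (κ * ϑ / (2 * (n : ℝ) + 1) * inn) :=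
          mul_le_mul_of_nonneg_right hκp (mul_nonneg (div_nonneg (mul_nonneg hκ.le hϑ0) hden.le) hin.le)
  have hL3 : κ * N - D ≤ τ / 2 * κ * (lamlow ^ (2 * n) * inn) := by
    have e : Γ * lamlow ^ (2 * n) * (σ * inn) + Γ * lamlow ^ (2 * n) * (κ * ϑ / (2 * (n : ℝ) + 1) * inn) =
        (Γ * (σ + κ * ϑ / (2 * (n : ℝ) + 1))) * (lamlow ^ (2 * n) * inn) := by ring
    have h4 : (Γ * (σ + κ * ϑ / (2 * (n : ℝ) + 1))) * (lamlow ^ (2 * n) * inn) ≤ (τ / 2 * κ) * (lamlow ^ (2 * n) * inn) :=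
      mul_le_mul_of_nonneg_right hlo (mul_nonneg hlowpos.le hin.le)
    linarith [hL, hU2, hL1, e, h4]
  have hL4 : κ * N - D ≤ τ / 2 * κ * N :=
    hL3.trans (mul_le_mul_of_nonneg_left hNlow (mul_nonneg (by linarith) hκ.le))
  have hDlo : κ * N ≤ Real.exp τ * D := by
    have hD0 : (1 - τ / 2) * (κ * N) ≤ D := by linarith
    have hpos' : 0 ≤ τ * (1 - τ) / 2 * (κ * N) := mul_nonneg (div_nonneg (mul_nonneg hτ0 (by linarith)) (by norm_num)) hκN
    have e5 : (1 + τ) * ((1 - τ / 2) * (κ * N)) = κ * N + τ * (1 - τ) / 2 * (κ * N) := by ring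
    have h6 : (1 + τ) * ((1 - τ / 2) * (κ * N)) ≤ Real.exp τ * ((1 - τ / 2) * (κ * N)) :=
      mul_le_mul_of_nonneg_right hexp1 (mul_nonneg (by linarith) hκN)
    have h7 : Real.exp τ * ((1 - τ / 2) * (κ * N)) ≤ Real.exp τ * D := mul_le_mul_of_nonneg_left hD0 (Real.exp_pos τ).le
    linarith
  exact ⟨hNpos, hDup, hDlo⟩

/-! ## §4 ★★ The off-diagonal clause from norm-currency concentration -/

/-- A finite block of squared coefficients inside `range M` is at most `nv`. [folklore] -/
theorem sum_sq_le_nv {A : ℝ} (hA : HasSum (fun k => a k ^ 2) A) {A' nv : ℝ} (hA' : A = A') (hAnv : A' ≤ nv) {S : Finset ℕ} {M : ℕ} (hS : S ⊆ range M) :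
    ∑ k ∈ S, a k ^ 2 ≤ nv := by
  subst hA'
  have h := sum_le_of_hasSum hA (fun k => sq_nonneg _) M
  exact ((Finset.sum_le_sum_of_subset_of_nonneg hS fun k _ _ => sq_nonneg (a k)).trans h).trans hAnv

/-- Mass outside the window but inside `range M`: `Σ_{k<M, k∉W} a_k² ≤ nv − Σ_W a_k² ≤ ϑ·nv` under concentration `nv ≤ (1+ϑ)Σ_W a²`. [folklore] -/
theorem sum_sdiff_sq_le {A : ℝ} (hA : HasSum (fun k => a k ^ 2) A) {nv : ℝ} (hAnv : A ≤ nv) {W : Finset ℕ} {M : ℕ} (hW : W ⊆ range M)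
    {ϑ : ℝ} (hϑ0 : 0 ≤ ϑ) (hconc : nv ≤ (1 + ϑ) * ∑ k ∈ W, a k ^ 2) :
    ∑ k ∈ range M \ W, a k ^ 2 ≤ ϑ * nv := by
  have h := sum_le_of_hasSum hA (fun k => sq_nonneg _) M
  have hs : ∑ k ∈ range M \ W, a k ^ 2 + ∑ k ∈ W, a k ^ 2 = ∑ k ∈ range M, a k ^ 2 := Finset.sum_sdiff hW
  have hWnv : ∑ k ∈ W, a k ^ 2 ≤ nv := sum_sq_le_nv hA rfl hAnv hW
  nlinarith [mul_le_mul_of_nonneg_left hWnv hϑ0]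

/-- Cauchy–Schwarz for `Σ_S |a_k|·|b_k|`. [folklore] -/
theorem sum_abs_mul_abs_le_sqrt (S : Finset ℕ) :
    ∑ k ∈ S, |a k| * |b k| ≤ Real.sqrt (∑ k ∈ S, a k ^ 2) * Real.sqrt (∑ k ∈ S, b k ^ 2) := by
  have h := Real.sum_mul_le_sqrt_mul_sqrt S (fun k => |a k|) (fun k => |b k|)
  simpa only [sq_abs] using h

/-- ★★ **Cross coupling from norm-currency concentration.**  Two coefficient sequences `a`, `b` concentrated in windows `W_a, W_b ⊆ [0,M)` (`nv ≤ (1+ϑ)·in`),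
a pivot `κ ≥ λ_M`, `κ ≥ 0`; `ω₀` bounds `|λ_k − κ|` below `M`, `ω₁` bounds it on `W_a ∩ W_b`.  Then
`|D_{ab} − κN_{ab}| ≤ (λ_0^{2n}(ω₁ + 2√ϑ·ω₀) + κ^{2n+1}ϑ/(2n+1))·√nv_a·√nv_b`. [cite: ReedSimonIV1978, Thm. XIII.1] [cite: Luscher1983, §3] -/
theorem cross_sharp (hanti : Antitone lam) (hnn : ∀ k, 0 ≤ lam k) (n M : ℕ) {κ : ℝ} (hκM : lam M ≤ κ) (hκ0 : 0 ≤ κ)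
    {Nab Dab Aa Ab nva nvb : ℝ}
    (hNab : HasSum (fun k => lam k ^ (2 * n) * (a k * b k)) Nab) (hDab : HasSum (fun k => lam k ^ (2 * n + 1) * (a k * b k)) Dab)
    (hAa : HasSum (fun k => a k ^ 2) Aa) (hAb : HasSum (fun k => b k ^ 2) Ab) (hAa' : Aa ≤ nva) (hAb' : Ab ≤ nvb)
    (hnva : 0 < nva) (hnvb : 0 < nvb)
    {Wa Wb : Finset ℕ} (hWa : Wa ⊆ range M) (hWb : Wb ⊆ range M)
    {ϑ : ℝ} (hϑ0 : 0 ≤ ϑ) (hca : nva ≤ (1 + ϑ) * ∑ k ∈ Wa, a k ^ 2) (hcb : nvb ≤ (1 + ϑ) * ∑ k ∈ Wb, b k ^ 2)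
    {ω₀ ω₁ : ℝ} (hω₀ : 0 ≤ ω₀) (hω₁ : 0 ≤ ω₁) (hw₀ : ∀ k, k < M → |lam k - κ| ≤ ω₀) (hw₁ : ∀ k ∈ Wa ∩ Wb, |lam k - κ| ≤ ω₁) :
    |Dab - κ * Nab| ≤ (lam 0 ^ (2 * n) * (ω₁ + 2 * Real.sqrt ϑ * ω₀) + κ ^ (2 * n + 1) / (2 * (n : ℝ) + 1) * ϑ) *
      (Real.sqrt nva * Real.sqrt nvb) := by
  -- abbreviations
  set sa := Real.sqrt nva with hsa
  set sb := Real.sqrt nvb with hsb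
  have hsa0 : 0 < sa := Real.sqrt_pos.2 hnva
  have hsb0 : 0 < sb := Real.sqrt_pos.2 hnvb
  have hsasq : sa ^ 2 = nva := Real.sq_sqrt hnva.le
  have hsbsq : sb ^ 2 = nvb := Real.sq_sqrt hnvb.le
  set c : ℝ := κ ^ (2 * n + 1) / (2 * (n : ℝ) + 1) with hc
  have hden : (0 : ℝ) < 2 * (n : ℝ) + 1 := by positivity
  have hc0 : 0 ≤ c := div_nonneg (pow_nonneg hκ0 _) hden.le
  set t : ℝ := sb / sa with htdef
  have ht : 0 < t := div_pos hsb0 hsa0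
  -- the series of `λ^{2n}(λ − κ) a b`
  set f : ℕ → ℝ := fun k => lam k ^ (2 * n) * ((lam k - κ) * (a k * b k)) with hfdef
  have hSab : HasSum f (Dab - κ * Nab) := by
    have := hDab.sub (hNab.mul_left κ)
    refine this.congr_fun fun k => ?_
    simp only [hfdef]; ring
  -- AM–GM majorant of the tail
  set g : ℕ → ℝ := fun k => (c * t / 2) * a k ^ 2 + (c / (2 * t)) * b k ^ 2 with hgdef
  have hg : HasSum g ((c * t / 2) * Aa + (c / (2 * t)) * Ab) := (hAa.mul_left _).add (hAb.mul_left _)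
  have hfg : ∀ k, M ≤ k → |f k| ≤ g k := by
    intro k hk
    have hkκ : lam k ≤ κ := (hanti hk).trans hκM
    have hw : lam k ^ (2 * n) * (κ - lam k) ≤ c := by
      have h := pow_mul_sub_le (hnn k) hkκ (2 * n)
      rw [hc]
      calc lam k ^ (2 * n) * (κ - lam k) ≤ κ ^ (2 * n + 1) / (((2 * n : ℕ) : ℝ) + 1) := h
        _ = κ ^ (2 * n + 1) / (2 * (n : ℝ) + 1) := by push_cast; ring
    have habs : |f k| = lam k ^ (2 * n) * (κ - lam k) * |a k * b k| := by
      simp only [hfdef]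
      rw [abs_mul, abs_mul, abs_of_nonneg (pow_nonneg (hnn k) _), abs_of_nonpos (sub_nonpos.2 hkκ)]
      ring
    have ham := abs_mul_le_amgm ht (a k) (b k)
    calc |f k| = lam k ^ (2 * n) * (κ - lam k) * |a k * b k| := habs
      _ ≤ c * |a k * b k| := mul_le_mul_of_nonneg_right hw (abs_nonneg _)
      _ ≤ c * ((t * a k ^ 2 + b k ^ 2 / t) / 2) := mul_le_mul_of_nonneg_left ham hc0
      _ = g k := by simp only [hgdef]; field_simp
  have htail1 := tail_le_of_le hSab hg M fun k hk => (le_abs_self _).trans (hfg k hk)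
  have htail2 := tail_le_of_le hSab.neg hg M fun k hk => (neg_le_abs _).trans (hfg k hk)
  have hgs : ∑ k ∈ range M, g k = (c * t / 2) * ∑ k ∈ range M, a k ^ 2 + (c / (2 * t)) * ∑ k ∈ range M, b k ^ 2 := by
    simp only [hgdef]; rw [Finset.sum_add_distrib, ← Finset.mul_sum, ← Finset.mul_sum]
  have hnegs : ∑ k ∈ range M, (fun k => -f k) k = -∑ k ∈ range M, f k := by
    simp only [Finset.sum_neg_distrib]
  -- out-masses
  have hMa : ∑ k ∈ range M, a k ^ 2 ≥ ∑ k ∈ Wa, a k ^ 2 := Finset.sum_le_sum_of_subset_of_nonneg hWa fun k _ _ => sq_nonneg (a k)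
  have hMb : ∑ k ∈ range M, b k ^ 2 ≥ ∑ k ∈ Wb, b k ^ 2 := Finset.sum_le_sum_of_subset_of_nonneg hWb fun k _ _ => sq_nonneg (b k)
  have hWanv : ∑ k ∈ Wa, a k ^ 2 ≤ nva := sum_sq_le_nv hAa rfl hAa' hWa
  have hWbnv : ∑ k ∈ Wb, b k ^ 2 ≤ nvb := sum_sq_le_nv hAb rfl hAb' hWb
  have houta : Aa - ∑ k ∈ range M, a k ^ 2 ≤ ϑ * nva := by nlinarith [mul_le_mul_of_nonneg_left hWanv hϑ0]
  have houtb : Ab - ∑ k ∈ range M, b k ^ 2 ≤ ϑ * nvb := by nlinarith [mul_le_mul_of_nonneg_left hWbnv hϑ0]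
  have hTail : |(Dab - κ * Nab) - ∑ k ∈ range M, f k| ≤ c * ϑ * (sa * sb) := by
    have hct0 : 0 ≤ c * t / 2 := by positivity
    have hct1 : 0 ≤ c / (2 * t) := by positivity
    have hG : (c * t / 2) * Aa + (c / (2 * t)) * Ab - ∑ k ∈ range M, g k ≤ c * ϑ * (sa * sb) := by
      rw [hgs]
      have h1 : (c * t / 2) * (Aa - ∑ k ∈ range M, a k ^ 2) ≤ (c * t / 2) * (ϑ * nva) := mul_le_mul_of_nonneg_left houta hct0
      have h2 : (c / (2 * t)) * (Ab - ∑ k ∈ range M, b k ^ 2) ≤ (c / (2 * t)) * (ϑ * nvb) := mul_le_mul_of_nonneg_left houtb hct1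
      have e : (c * t / 2) * (ϑ * nva) + (c / (2 * t)) * (ϑ * nvb) = c * ϑ * (sa * sb) := by
        rw [htdef, ← hsasq, ← hsbsq]; field_simp; ring
      linarith [h1, h2, e]
    rw [abs_le]
    constructor
    · rw [hnegs] at htail2; linarith [htail2, hG]
    · linarith [htail1, hG]
  -- finite part
  have hIsub : Wa ∩ Wb ⊆ range M := (Finset.inter_subset_left).trans hWa
  have hFin : |∑ k ∈ range M, f k| ≤ lam 0 ^ (2 * n) * (ω₁ + 2 * Real.sqrt ϑ * ω₀) * (sa * sb) := by
    have hpt : ∀ k ∈ range M, |f k| ≤ lam 0 ^ (2 * n) * (|lam k - κ| * (|a k| * |b k|)) := by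
      intro k _
      simp only [hfdef]
      rw [abs_mul, abs_mul, abs_mul, abs_of_nonneg (pow_nonneg (hnn k) _)]
      exact mul_le_mul_of_nonneg_right (pow_le_pow_left₀ (hnn k) (hanti (Nat.zero_le k)) _) (by positivity)
    have h1 : |∑ k ∈ range M, f k| ≤ ∑ k ∈ range M, lam 0 ^ (2 * n) * (|lam k - κ| * (|a k| * |b k|)) :=
      (Finset.abs_sum_le_sum_abs _ _).trans (Finset.sum_le_sum hpt)
    rw [← Finset.mul_sum] at h1
    -- split `range M = (range M \ (Wa ∩ Wb)) ⊔ (Wa ∩ Wb)`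
    have hsplit : ∑ k ∈ range M, |lam k - κ| * (|a k| * |b k|) =
        ∑ k ∈ range M \ (Wa ∩ Wb), |lam k - κ| * (|a k| * |b k|) + ∑ k ∈ Wa ∩ Wb, |lam k - κ| * (|a k| * |b k|) :=
      (Finset.sum_sdiff hIsub).symm
    -- on the common window
    have hI : ∑ k ∈ Wa ∩ Wb, |lam k - κ| * (|a k| * |b k|) ≤ ω₁ * (sa * sb) := by
      have h2 : ∑ k ∈ Wa ∩ Wb, |lam k - κ| * (|a k| * |b k|) ≤ ∑ k ∈ Wa ∩ Wb, ω₁ * (|a k| * |b k|) :=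
        Finset.sum_le_sum fun k hk => mul_le_mul_of_nonneg_right (hw₁ k hk) (by positivity)
      rw [← Finset.mul_sum] at h2
      have h3 := sum_abs_mul_abs_le_sqrt (a := a) (b := b) (Wa ∩ Wb)
      have h4 : Real.sqrt (∑ k ∈ Wa ∩ Wb, a k ^ 2) ≤ sa := Real.sqrt_le_sqrt (sum_sq_le_nv hAa rfl hAa' hIsub)
      have h5 : Real.sqrt (∑ k ∈ Wa ∩ Wb, b k ^ 2) ≤ sb := Real.sqrt_le_sqrt (sum_sq_le_nv hAb rfl hAb' hIsub)
      have h6 : ∑ k ∈ Wa ∩ Wb, |a k| * |b k| ≤ sa * sb :=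
        h3.trans (mul_le_mul h4 h5 (Real.sqrt_nonneg _) hsa0.le)
      exact h2.trans (mul_le_mul_of_nonneg_left h6 hω₁)
    -- off the common window: each index misses `Wa` or misses `Wb`
    have hO : ∑ k ∈ range M \ (Wa ∩ Wb), |lam k - κ| * (|a k| * |b k|) ≤ ω₀ * (2 * Real.sqrt ϑ * (sa * sb)) := by
      have h2 : ∑ k ∈ range M \ (Wa ∩ Wb), |lam k - κ| * (|a k| * |b k|) ≤ ∑ k ∈ range M \ (Wa ∩ Wb), ω₀ * (|a k| * |b k|) :=
        Finset.sum_le_sum fun k hk => mul_le_mul_of_nonneg_right (hw₀ k (mem_range.1 (Finset.mem_sdiff.1 hk).1)) (by positivity)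
      rw [← Finset.mul_sum] at h2
      have hsub : range M \ (Wa ∩ Wb) ⊆ (range M \ Wa) ∪ (range M \ Wb) := by
        intro k hk
        rw [Finset.mem_sdiff, Finset.mem_inter, not_and_or] at hk
        rw [Finset.mem_union, Finset.mem_sdiff, Finset.mem_sdiff]
        rcases hk.2 with h | h
        · exact Or.inl ⟨hk.1, h⟩
        · exact Or.inr ⟨hk.1, h⟩
      have hnn' : ∀ k ∈ (range M \ Wa) ∪ (range M \ Wb), 0 ≤ |a k| * |b k| := fun k _ => by positivity
      have h3 : ∑ k ∈ range M \ (Wa ∩ Wb), |a k| * |b k| ≤ ∑ k ∈ (range M \ Wa) ∪ (range M \ Wb), |a k| * |b k| :=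
        Finset.sum_le_sum_of_subset_of_nonneg hsub fun k hk _ => hnn' k hk
      have h4 : ∑ k ∈ (range M \ Wa) ∪ (range M \ Wb), |a k| * |b k| ≤
          ∑ k ∈ range M \ Wa, |a k| * |b k| + ∑ k ∈ range M \ Wb, |a k| * |b k| := by
        have := Finset.sum_union_inter (s₁ := range M \ Wa) (s₂ := range M \ Wb) (f := fun k => |a k| * |b k|)
        have hi : 0 ≤ ∑ k ∈ (range M \ Wa) ∩ (range M \ Wb), |a k| * |b k| := Finset.sum_nonneg fun k _ => by positivity
        linarith
      -- `Σ_{range M \ Wa} |a||b| ≤ √(ϑ nva)·sb` and symmetrically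
      have hA1 : ∑ k ∈ range M \ Wa, |a k| * |b k| ≤ Real.sqrt (ϑ * nva) * sb := by
        have h5 := sum_abs_mul_abs_le_sqrt (a := a) (b := b) (range M \ Wa)
        have h6 : Real.sqrt (∑ k ∈ range M \ Wa, a k ^ 2) ≤ Real.sqrt (ϑ * nva) :=
          Real.sqrt_le_sqrt (sum_sdiff_sq_le hAa hAa' hWa hϑ0 hca)
        have h7 : Real.sqrt (∑ k ∈ range M \ Wa, b k ^ 2) ≤ sb :=
          Real.sqrt_le_sqrt (sum_sq_le_nv hAb rfl hAb' Finset.sdiff_subset)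
        exact h5.trans (mul_le_mul h6 h7 (Real.sqrt_nonneg _) (Real.sqrt_nonneg _))
      have hB1 : ∑ k ∈ range M \ Wb, |a k| * |b k| ≤ sa * Real.sqrt (ϑ * nvb) := by
        have h5 := sum_abs_mul_abs_le_sqrt (a := a) (b := b) (range M \ Wb)
        have h6 : Real.sqrt (∑ k ∈ range M \ Wb, a k ^ 2) ≤ sa :=
          Real.sqrt_le_sqrt (sum_sq_le_nv hAa rfl hAa' Finset.sdiff_subset)
        have h7 : Real.sqrt (∑ k ∈ range M \ Wb, b k ^ 2) ≤ Real.sqrt (ϑ * nvb) :=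
          Real.sqrt_le_sqrt (sum_sdiff_sq_le hAb hAb' hWb hϑ0 hcb)
        exact h5.trans (mul_le_mul h6 h7 (Real.sqrt_nonneg _) hsa0.le)
      have e1 : Real.sqrt (ϑ * nva) = Real.sqrt ϑ * sa := by rw [Real.sqrt_mul hϑ0]
      have e2 : Real.sqrt (ϑ * nvb) = Real.sqrt ϑ * sb := by rw [Real.sqrt_mul hϑ0]
      rw [e1] at hA1; rw [e2] at hB1
      have h8 : ∑ k ∈ range M \ (Wa ∩ Wb), |a k| * |b k| ≤ 2 * Real.sqrt ϑ * (sa * sb) := by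
        have := h3.trans (h4.trans (add_le_add hA1 hB1)); linarith
      exact h2.trans (mul_le_mul_of_nonneg_left h8 hω₀)
    have h9 : ∑ k ∈ range M, |lam k - κ| * (|a k| * |b k|) ≤ (ω₁ + 2 * Real.sqrt ϑ * ω₀) * (sa * sb) := by
      rw [hsplit]; linarith [hI, hO]
    exact h1.trans (by
      have := mul_le_mul_of_nonneg_left h9 (pow_nonneg (hnn 0) (2 * n))
      linarith [this])
  -- combine
  have hsum : |Dab - κ * Nab| ≤ |∑ k ∈ range M, f k| + |(Dab - κ * Nab) - ∑ k ∈ range M, f k| := by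
    have := abs_add_le (∑ k ∈ range M, f k) ((Dab - κ * Nab) - ∑ k ∈ range M, f k)
    rwa [add_sub_cancel] at this
  calc |Dab - κ * Nab| ≤ |∑ k ∈ range M, f k| + |(Dab - κ * Nab) - ∑ k ∈ range M, f k| := hsum
    _ ≤ lam 0 ^ (2 * n) * (ω₁ + 2 * Real.sqrt ϑ * ω₀) * (sa * sb) + c * ϑ * (sa * sb) := add_le_add hFin hTail
    _ = (lam 0 ^ (2 * n) * (ω₁ + 2 * Real.sqrt ϑ * ω₀) + κ ^ (2 * n + 1) / (2 * (n : ℝ) + 1) * ϑ) * (sa * sb) := by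
        rw [hc]; ring

end Summit.QuantumFields.YangMills.Theorems.FemtoTransferGap.SpecSum

end
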